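import Summits.QuantumFields.YangMills.Theorems.FluctuationComparisonRegPrIntLS2BetaRelativeKeyLemmaSharpTower
import Summits.QuantumFields.YangMills.Theorems.FluctuationComparisonRegPrIntLS2BetaKeyLemmaRecord
import HarnessLib

/-!
# S2β · letter (D♮)∕(D-stage) REL-TEL, the (C)-half — THE RELATIVE KEY LEMMA ON A `d = 3` TORUS FROM THE ONE-LEVEL STEP, SHARP WEIGHTS, GUARDED
# (relative twin of ✓px13 g23 `…KeyLemmaRecord.keyLemma_torus_of_step`: the two averaging towers `M^tU`, `M^tU₀` of a pair, the relative plaquette function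
# `f_t p := dist1((M^tU₀)(∂p)⁻¹·(M^tU)(∂p))`, per-level `hstep`∕`hj` for `t < m` ⟹ for every `t ≤ m`
# `‖f_t‖₂ ≤ exp((C₁Σθ) + Σε∕√L)·((√L)^t·‖f_0‖₂ + Σ_{s<t}(√L)^{t−1−s}·η_s)`)

Cell `ym3-torus` (rung R3 = continuum `SU(2)` Yang–Mills on the three-torus — NOT d = 4, NOT infinite volume, NOT a mass gap, NOT Clay).
Width seat «width 10» `ym3-torus-px10` (gen 23), FREE px helper on crux `stmt-QuantumFields-20520`, count-neutral, DEFINITION-FREE; own-risk brick of the px10 lane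
«(C)-half of letter (D♮)» (UV3-NODE §82).  The torus data of ✓`keyLemma_torus_of_step` (tent kernel: rows `= L²` ✓`tentKernel_row`, plaquette columns `≤ L⁻¹`
✓`tentKernel_colPlaq_three`, `≥ 0`) fed to ✓∕⧗`relKeyLemma_tower_upto_sharp`; the per-level `hstep`∕`hj` are HYPOTHESES in exactly the shape ✓∕⧗`relHstep_hj_bkg`
produces (`θ_t` = the history threshold entering the MAIN coefficient `1 + C₁θ_t`; `ε_t, η_t` = the BKG + supRel-priced source). ANY gauge group, ANY small-loop average,
ANY pair of level-`0` fields — the consumer (px12 g24's (H♭♭) discharger) takes the gauge-fixed pair and `m = K − J`.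
* ★★★ `relKeyLemma_torus_of_step`.

HONEST SCOPE.  Kernel bookkeeping over landed letters; nothing of Bałaban's asserted; the per-level inputs on the T³ record (BKG-tower `θ₀,t`, supRel `β♯_t`, the β-suppliers,
✓∕⧗`relHstep_hj_bkg` at each level of a good history), (H♭♭), (D-stage), GAP♯∘ (`stub_uniformFibreGapOrbit`), S2β, crux 20520 and `YM3TorusSU2` are NOT proved; no
registered stub is closed; the Yang–Mills mass gap is NOT proved.  Sorry-free, axioms standard.
References: T. Bałaban, CMP **98** (1985) 17–51 [Balaban1985Averaging] ((19) p.21); CMP **99** (1985) 75–102 [Balaban1985RegularSpaces] (Lemma 1 p.79, Thm 2 p.83).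
-/

set_option autoImplicit false

noncomputable section

open Finset
open scoped BigOperators

namespace Summit.QuantumFields.YangMills.Theorems.FluctuationComparisonRegPrIntLS2BetaRelativeKeyLemmaTorus

open Literature.MathematicalPhysics.QuantumFieldTheory.Balaban1983to89
open T4Continuum BlockAveraging
open B10Eq47AxialChi (shiftN)
open Summit.QuantumFields.YangMills.Theorems.FluctuationComparisonRegPrIntLS2BetaTentKernelTorus (tentKernel_row tentKernel_nonneg)
open Summit.QuantumFields.YangMills.Theorems.FluctuationComparisonRegPrIntLS2BetaKeyLemmaRecord (tentKernel_colPlaq_three)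
open Summit.QuantumFields.YangMills.Theorems.FluctuationComparisonRegPrIntLS2BetaRelativeKeyLemmaSharpTower (relKeyLemma_tower_upto_sharp)

variable {P : Params} {G : Type*} [GaugeGroup G]

/-- ★★★ **THE RELATIVE KEY LEMMA ON A `d = 3` TORUS FROM THE ONE-LEVEL STEP, SHARP WEIGHTS, GUARDED** (`M^tU := Averaging.iter (blockAvg ℰ) t U`, likewise
for `U₀`; `f_t p := dist1((M^tU₀)(∂p)⁻¹·(M^tU)(∂p))`; `m ≤ P.m + P.K`; for `t < m`: thresholds `θ_t ≥ 0`, source coefficients `ε_t, η_t ≥ 0`, a junk `j_t` with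
(hstep) `f_{t+1} Q ≤ (1 + C₁θ_t)·Σ_p 𝐊(Q,p)·f_t p + j_t Q` and (hj) `√Σ_Q j_t Q² ≤ ε_t·‖f_t‖₂ + η_t`).  THEN for every `t ≤ m`
`‖f_t‖₂ ≤ exp(Σ_{i<m}(C₁θ_i + ε_i∕√L))·((√L)^t·‖f_0‖₂ + Σ_{s<t} (√L)^{t−1−s}·η_s)`. [cite: Balaban1985Averaging, (19) p.21; Balaban1985RegularSpaces, Thm 2 p.83] -/
theorem relKeyLemma_torus_of_step (hd : P.d = 3) (ℰ : LoopAverage G) {m : ℕ} (hm : m ≤ P.m + P.K) (U U₀ : GaugeField P 0 G)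
    (θ ε η : ℕ → ℝ) (hθ : ∀ t, t < m → 0 ≤ θ t) (hε : ∀ t, t < m → 0 ≤ ε t) (hη : ∀ t, t < m → 0 ≤ η t) {C₁ : ℝ} (hC₁ : 0 ≤ C₁)
    (j : (t : ℕ) → Plaq P (t + 1) → ℝ)
    (hstep1 : ∀ t, t < m → ∀ Q : Plaq P (t + 1),
      dist1 ((GaugeField.plaqHol (Averaging.iter (fun k => blockAvg (P := P) (j := k) ℰ) (t + 1) U₀) Q)⁻¹ *
          GaugeField.plaqHol (Averaging.iter (fun k => blockAvg (P := P) (j := k) ℰ) (t + 1) U) Q) ≤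
        (1 + C₁ * θ t) * ∑ p : Plaq P t, ((P.L : ℝ) ^ P.d)⁻¹ * (((block Q.src).filter (fun x : Site P t => p.μ = Q.μ ∧ p.ν = Q.ν ∧
            ∃ a ∈ range P.L, ∃ b ∈ range P.L, p.src = shiftN (shiftN x Q.μ a) Q.ν b)).card : ℝ) *
            dist1 ((GaugeField.plaqHol (Averaging.iter (fun k => blockAvg (P := P) (j := k) ℰ) t U₀) p)⁻¹ *
              GaugeField.plaqHol (Averaging.iter (fun k => blockAvg (P := P) (j := k) ℰ) t U) p) + j t Q)
    (hj1 : ∀ t, t < m → √(∑ Q, j t Q ^ 2) ≤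
      ε t * √(∑ p : Plaq P t, dist1 ((GaugeField.plaqHol (Averaging.iter (fun k => blockAvg (P := P) (j := k) ℰ) t U₀) p)⁻¹ *
        GaugeField.plaqHol (Averaging.iter (fun k => blockAvg (P := P) (j := k) ℰ) t U) p) ^ 2) + η t) :
    ∀ t, t ≤ m → √(∑ p : Plaq P t, dist1 ((GaugeField.plaqHol (Averaging.iter (fun k => blockAvg (P := P) (j := k) ℰ) t U₀) p)⁻¹ *
        GaugeField.plaqHol (Averaging.iter (fun k => blockAvg (P := P) (j := k) ℰ) t U) p) ^ 2) ≤
      Real.exp (∑ i ∈ range m, (C₁ * θ i + ε i / Real.sqrt (P.L : ℝ))) *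
        (Real.sqrt (P.L : ℝ) ^ t * √(∑ p : Plaq P 0, dist1 ((GaugeField.plaqHol U₀ p)⁻¹ * GaugeField.plaqHol U p) ^ 2) +
          ∑ s ∈ range t, Real.sqrt (P.L : ℝ) ^ (t - 1 - s) * η s) := by
  classical
  set av : (k : ℕ) → Averaging P k G := fun k => blockAvg (P := P) (j := k) ℰ with hav
  have hL1 : (1 : ℝ) ≤ P.L := by exact_mod_cast P.L_pos
  have hlev : ∀ t, t < m → t + 1 ≤ P.m + P.K := fun t ht => by omega
  have h := relKeyLemma_tower_upto_sharp (fun t => Plaq P t) m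
    (fun t p => dist1 ((GaugeField.plaqHol (Averaging.iter av t U₀) p)⁻¹ * GaugeField.plaqHol (Averaging.iter av t U) p))
    (fun t p => GaugeGroup.dist1_nonneg _)
    (fun t Q p => ((P.L : ℝ) ^ P.d)⁻¹ * (((block Q.src).filter (fun x : Site P t => p.μ = Q.μ ∧ p.ν = Q.ν ∧
      ∃ a ∈ range P.L, ∃ b ∈ range P.L, p.src = shiftN (shiftN x Q.μ a) Q.ν b)).card : ℝ))
    (fun t _ Q p => tentKernel_nonneg Q.src p Q.μ Q.ν) hL1
    (fun _ => (P.L : ℝ) ^ 2) (fun _ => (P.L : ℝ)⁻¹) (fun t => C₁ * θ t) ε η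
    (fun t _ => by positivity) (fun t _ => by field_simp)
    (fun t ht Q => (tentKernel_row (hlev t ht) Q.src Q.hμν).le) (fun t ht p => tentKernel_colPlaq_three hd (hlev t ht) p)
    (fun t ht => mul_nonneg hC₁ (hθ t ht)) hε hη j (fun t ht Q => hstep1 t ht Q) (fun t ht => hj1 t ht)
  intro t ht
  exact h t ht

end Summit.QuantumFields.YangMills.Theorems.FluctuationComparisonRegPrIntLS2BetaRelativeKeyLemmaTorus

end
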